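import Summits.MatrixMultiplication.MatrixMultiplication.Theorems.SoloInformedXPairEnding
import Summits.MatrixMultiplication.MatrixMultiplication.Theorems.SoloInformedAllLEnding

/-!
# THEOREM 8.20 (every chart): a heavy family of poor rows of `b` forces `n³ ≤ 213073920 · (r·|S⁰|)`

This work, §8.8 (T12)(f), (T13) and C3-m2 §5.2, §5.6 (B) (gen 108: the kernel glue — THEOREM 8.20 is now ONE
kernel theorem). Setting: a CU13-Def-12 realization of `⟨n,n,n⟩` in `𝒮(S⁰ × S¹, ±)`
[CohnUmans2013, arXiv:1207.6528, Def. 12] — equation data `D : Data ι G` (no 2-torsion), a chart `Φ`, full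
separation, class map `κ : G → R`, `M := |R|·|S⁰|`.

`Data.poor_rows_cube_le`: if a family `J_p` with `n ≤ 2|J_p|` consists of rows of `b` taking at most `17` values
each, then `n³ ≤ 213073920·M` (`213073920 = 2·184320·578`). Proof = the case tree of THEOREM 8.20 run in the
kernel with the typing threshold `t = ⌊n/184320⌋`: Step 0 common constancy cells with a reference row `j₁`
(`exists_common_cell`, size `≥ ⌊n/289⌋`); Step 1 `Data.pair_typed` on every pair `(j, j₁)` (bound, or type 𝓧,
or type 𝓛); Step 2 `Data.xpair_ending` if some pair is 𝓧; Step 3 `Data.allL_ending` if every pair is 𝓛 (the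
reference pattern `α_i = a(i, j₁)`); small `n < 184320` by `n² ≤ M`.
-/

namespace Summit.MatrixMultiplication.MatrixMultiplication.Theorems.TwistedTPP

namespace FibreLines

variable {ι G : Type*} [AddCommGroup G]
variable {G₀ : Type*} [AddCommGroup G₀] {R : Type*}

/-- `n² ≤ r·|S⁰|` for every fully separated realization with `n ≥ 1` (one row of `b` against all columns). -/
theorem Data.sq_le [Fintype ι] [DecidableEq ι] [Fintype G₀] [DecidableEq G₀] [Fintype R] [DecidableEq R]
    (D : Data ι G) (Φ : Chart ι G₀) (κ : G → R) (hκ : ∀ x y, κ x = κ y → SignEq x y) (hsep : D.SepAll Φ)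
    (j₀ : ι) : Fintype.card ι * Fintype.card ι ≤ Fintype.card R * Fintype.card G₀ := by
  have h := D.card_mul_le_of_b_rowsOn₂ Φ κ hκ hsep {j₀} Finset.univ fun j hj j' hj' k _ => by
    rw [Finset.mem_singleton] at hj hj'
    rw [hj, hj']
    exact SignEq.refl _
  simpa only [Finset.card_univ, Finset.card_singleton, mul_one] using h

/-- **THEOREM 8.20 (every chart, one kernel theorem).** A family `J_p` of rows of `b` with `n ≤ 2|J_p|`, each
taking at most `17` values, forces `n³ ≤ 213073920 · (r·|S⁰|)`. [this work §8.8 (T12)(f), (T13); C3-m2 §5.2, §5.6] -/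
theorem Data.poor_rows_cube_le [Fintype ι] [DecidableEq ι] [Fintype G₀] [DecidableEq G₀] [Fintype R]
    [DecidableEq R] [DecidableEq G] (hG : ∀ x : G, x = -x → x = 0) (D : Data ι G) (Φ : Chart ι G₀)
    (κ : G → R) (hκ : ∀ x y, κ x = κ y → SignEq x y) (hsep : D.SepAll Φ) (Jp : Finset ι)
    (hJp : Fintype.card ι ≤ 2 * Jp.card)
    (hpoor : ∀ j ∈ Jp, ((Finset.univ : Finset ι).image fun k => D.b j k).card ≤ 17) :
    Fintype.card ι ^ 3 ≤ 213073920 * (Fintype.card R * Fintype.card G₀) := by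
  classical
  set n := Fintype.card ι with hn
  set M := Fintype.card R * Fintype.card G₀ with hM
  rcases Nat.eq_zero_or_pos n with h0 | hpos
  · simp [h0]
  -- the reference row and `n² ≤ M`
  obtain ⟨j₁, hj₁⟩ : Jp.Nonempty := by rw [← Finset.card_pos]; omega
  have hsq : n * n ≤ M := D.sq_le Φ κ hκ hsep j₁
  by_cases hsmall : n < 184320
  · calc n ^ 3 = n * (n * n) := by ring
      _ ≤ 184320 * M := Nat.mul_le_mul hsmall.le hsq
      _ ≤ 213073920 * M := by omega
  push Not at hsmall
  -- the typing threshold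
  set t : ℕ := n / 184320 with ht
  have htn : n ≤ 2 * 184320 * t := by omega
  have hbudget : 4608 * (20 * t + 1) ≤ n := by omega
  have hbudget2 : 576 * (6 * t + 1) ≤ n := by omega
  have hs : n ≤ 578 * (n / (17 * 17)) := by omega
  have hts : t < n / (17 * 17) := by omega
  -- Step 0: common constancy cells with the reference row
  have hcell : ∀ j ∈ Jp, ∃ Ks : Finset ι, ∃ w w' : G, n / (17 * 17) ≤ Ks.card ∧
      (∀ k ∈ Ks, D.b j k = w) ∧ ∀ k ∈ Ks, D.b j₁ k = w' := fun j hj =>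
    exists_common_cell (fun k => D.b j k) (fun k => D.b j₁ k) 17 (hpoor j hj) (hpoor j₁ hj₁)
  choose! Ks w w' hKs hw hw' using hcell
  -- Step 1: every pair `(j, j₁)` is bounded or typed
  by_cases hbound : ∃ j ∈ Jp, n * t * (Ks j).card ≤ M
  · obtain ⟨j, hj, hb⟩ := hbound
    calc n ^ 3 = n * n * n := by ring
      _ ≤ n * (2 * 184320 * t) * (578 * (Ks j).card) :=
        Nat.mul_le_mul (Nat.mul_le_mul_left _ htn) (hs.trans (Nat.mul_le_mul_left _ (hKs j hj)))
      _ = 213073920 * (n * t * (Ks j).card) := by ring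
      _ ≤ 213073920 * M := Nat.mul_le_mul_left _ hb
  have htyped : ∀ j ∈ Jp, ∃ Ig : Finset ι, n < Ig.card + t ∧
      ((¬ SignEq (w j) (w' j) ∧ ∀ i ∈ Ig, SignEq (D.a i j) (w' j) ∧ SignEq (D.a i j₁) (w j)) ∨
        (SignEq (w j) (w' j) ∧ ∀ i ∈ Ig, SignEq (D.a i j) (D.a i j₁))) := by
    intro j hj
    refine (D.pair_typed hG Φ κ hκ hsep (Ks j) (fun k hk => Or.inl (hw j hj k hk))
      (fun k hk => Or.inl (hw' j hj k hk)) t).resolve_left fun hb => hbound ⟨j, hj, hb⟩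
  by_cases hX : ∃ j ∈ Jp, ∃ Ig : Finset ι, n < Ig.card + t ∧ ¬ SignEq (w j) (w' j) ∧
      ∀ i ∈ Ig, SignEq (D.a i j) (w' j) ∧ SignEq (D.a i j₁) (w j)
  · -- Step 2: an 𝓧-typed pair
    obtain ⟨j, hj, Ig, hIg, hne, ha⟩ := hX
    have hP : ∀ j'' ∈ Jp, ∃ Ks' : Finset ι, ∃ u'' u : G, n / (17 * 17) ≤ Ks'.card ∧ t < Ks'.card ∧
        (∀ k ∈ Ks', SignEq (D.b j'' k) u'') ∧ ∀ k ∈ Ks', SignEq (D.b j₁ k) u := fun j'' hj'' =>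
      ⟨Ks j'', w j'', w' j'', hKs j'' hj'', lt_of_lt_of_le hts (hKs j'' hj''),
        fun k hk => Or.inl (hw j'' hj'' k hk), fun k hk => Or.inl (hw' j'' hj'' k hk)⟩
    rcases D.xpair_ending hG Φ κ hκ hsep hne Ig t hIg ha Jp (n / (17 * 17)) hP hJp hbudget2 with
      hb | hb | hb | hb
    · calc n ^ 3 = n * n * n := by ring
        _ ≤ n * (2 * 184320 * t) * (578 * (n / (17 * 17))) :=
          Nat.mul_le_mul (Nat.mul_le_mul_left _ htn) hs
        _ = 213073920 * (n * t * (n / (17 * 17))) := by ring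
        _ ≤ 213073920 * M := Nat.mul_le_mul_left _ hb
    · have h2 : n ≤ 2 * (n - t) := by omega
      calc n ^ 3 = n * n * n := by ring
        _ ≤ n * (2 * 184320 * t) * (2 * (n - t)) := Nat.mul_le_mul (Nat.mul_le_mul_left _ htn) h2
        _ = 737280 * (n * t * (n - t)) := by ring
        _ ≤ 737280 * M := Nat.mul_le_mul_left _ hb
        _ ≤ 213073920 * M := by omega
    · have h2 : n ≤ 2 * (n - t - t) := by omega
      calc n ^ 3 = n * n * n := by ring
        _ ≤ n * (2 * 184320 * t) * (2 * (n - t - t)) := Nat.mul_le_mul (Nat.mul_le_mul_left _ htn) h2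
        _ = 737280 * (n * t * (n - t - t)) := by ring
        _ ≤ 737280 * M := Nat.mul_le_mul_left _ hb
        _ ≤ 213073920 * M := by omega
    · exact hb.trans (by omega)
  · -- Step 3: every pair is 𝓛-typed; the reference pattern `α_i = a(i, j₁)`
    have hL : ∀ j ∈ Jp, ∃ E : Finset ι, E.card ≤ t ∧ ∀ i, i ∉ E → SignEq (D.a i j) (D.a i j₁) := by
      intro j hj
      obtain ⟨Ig, hIg, hk⟩ := htyped j hj
      rcases hk with ⟨hne, ha⟩ | ⟨-, ha⟩
      · exact absurd ⟨j, hj, Ig, hIg, hne, ha⟩ hX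
      · refine ⟨Finset.univ \ Ig, ?_, fun i hi => ha i ?_⟩
        · rw [Finset.card_univ_sdiff]; omega
        · by_contra h
          exact hi (Finset.mem_sdiff.2 ⟨Finset.mem_univ _, h⟩)
    choose! Ec hEcc hEca using hL
    rcases D.allL_ending hG Φ κ hκ hsep Jp (fun i => D.a i j₁) t Ec (fun j hj => ⟨hEcc j hj, hEca j hj⟩)
        hJp hbudget with hb | hb | hb
    · have h4 : n ≤ 4 * (Jp.card - 4 * t) := by omega
      calc n ^ 3 = n * n * n := by ring
        _ ≤ n * (2 * 184320 * t) * (4 * (Jp.card - 4 * t)) :=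
          Nat.mul_le_mul (Nat.mul_le_mul_left _ htn) h4
        _ = 1474560 * (n * t * (Jp.card - 4 * t)) := by ring
        _ ≤ 1474560 * M := Nat.mul_le_mul_left _ hb
        _ ≤ 213073920 * M := by omega
    · calc n ^ 3 = n ^ 2 * n := by ring
        _ ≤ n ^ 2 * (2 * 184320 * t) := Nat.mul_le_mul_left _ htn
        _ = 368640 * (n ^ 2 * t) := by ring
        _ ≤ 368640 * (2 * M) := Nat.mul_le_mul_left _ hb
        _ ≤ 213073920 * M := by omega
    · exact hb.trans (by omega)

end FibreLines

end Summit.MatrixMultiplication.MatrixMultiplication.Theorems.TwistedTPP
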